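import Literature.NumberTheory.LFunctions.PolyaSignChanges

/-!
# Shared definitions for the moment-method proof of `Grosswald1967_thmB` (Pólya's sign-change theorem)

Topic `Literature/NumberTheory/LFunctions` (namespace `Literature.NumberTheory.LFunctions`, grouping
sub-namespace `PolyaSignChanges`).  This module holds ONLY the definitions shared by the three proof files
of the A1 programme (rh-inputs cell, 2026-08-28) and the kernel-checked composition
`grosswald1967_thmB_of : PieceA → PieceB → Grosswald1967_thmB`; the pieces themselves are proved in
`PolyaSignChangesCounting.lean` (PieceA: Descartes–Laguerre counting of the sign changes of truncated
Mellin moments against a pole pair), `PolyaSignChangesLaguerre.lean` (Laguerre's rule of signs,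
`SeqSignChangesLE`) and `PolyaSignChangesInfiniteHeight.lean` (PieceB: the pole nearest to a large
generic real point; covers Pólya's gap case `γ = +∞`).  Nothing here bears on the truth of RH; no
summit statement is proved.

## Architecture (log-variable `u = log x`, `G(u) = g(e^u)`, `F = Landau.mellinIoi g`)

* moments `m_k(λ) := ∫₁^∞ g(t) (log t)^k t^{-(λ+1)} dt = (-1)^k F^{(k)}(λ)` (`λ > σ₁` real);
* (Laguerre–Descartes) the number of sign changes of the TRUNCATED moment sequence
  `k ↦ ∫₁^y g(t)(log t)^k t^{-(λ+1)} dt`, `k = 0..K`, is at most the longest alternating sign chain of `g`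
  in `(1, y]`;
* (pole-pair asymptotics) if the continuation `Ψ` of `F` is holomorphic on the closed disc `|s − λ| ≤ R'`
  except for a conjugate pair of genuine poles `ρ, ρ̄` (`ρ = β + iγ`, `γ > 0`, `R := |λ − ρ| < R'`), then
  `m_k/k!` has the sign of `cos((m+k)φ + α)`, `φ = arctan(γ/(λ−β))`, for all large `k` off an exceptional
  set of bounded gaps — sign changes in `k` of density `φ/π`; the tail beyond `y = e^{xk/λ}` is negligible
  under the tail inequality `x·e^{1−x(λ−σ₁)/λ}·R < λ`;
* hence (`PieceA`) sign-chain density `≥ λ φ/(π x) = polePairRate λ x ρ`;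
* (`PieceB`, pole bookkeeping) under the hypotheses of Theorem B (pole-free box of half-height `Γ`, `Φ`
  meromorphic on `{θ − ε₀ < re}`, not continuable past `θ`) for every `ε > 0` some admissible
  `(λ, x, R', ρ, Ψ)` exists with `λ·arctan(γ/(λ−β))/x ≥ Γ − ε` (nearest pole of the normal form of `Φ`
  to a large generic real `λ`; covers both `P ≠ ∅` and `P = ∅`).

Source of the statement: Grosswald, TAMS 126 (1967) §4 Theorem B pp. 4–5 (statement only; proofs:
Pólya 1930, Steinig 1969).  Method: the Descartes–Laguerre moment method (Kaczorowski, Acta Arith. 45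
(1985) 65–74, doi:10.4064/aa-45-1-65-74, where it yields even the liminf for `ψ(x) − x`); the
decomposition typed here is the cell's own and is not a port of a printed proof.
[cite: Grosswald1967, §4 Thm B pp. 4–5]
-/

noncomputable section

open Complex Set MeasureTheory Filter Topology Metric

namespace Literature.NumberTheory.LFunctions.PolyaSignChanges

/-- Sign-chain density `≥ D` in the LIMSUP form of Theorem B: for every `c < D` and every `y₀` there is
`y ≥ y₀` with an alternating chain of `g` in `(1, y]` of length `≥ c log y` (the `limsup W(y)/log y ≥ D` of Theorem B). [cite: Grosswald1967, §4 Thm B pp. 4–5] -/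
def SignChainDensity (g : ℝ → ℝ) (D : ℝ) : Prop :=
  ∀ c : ℝ, c < D → ∀ y₀ : ℝ, ∃ y : ℝ, y₀ ≤ y ∧ ∃ n : ℕ, HasSignChain g y n ∧ c * Real.log y ≤ n

/-- The LIMINF form (what the moment method actually yields; not needed for Theorem B). [cite: Grosswald1967, §4 Thm B pp. 4–5] -/
def SignChainLowerDensity (g : ℝ → ℝ) (D : ℝ) : Prop :=
  ∀ c : ℝ, c < D → ∃ y₁ : ℝ, ∀ y : ℝ, y₁ ≤ y → ∃ n : ℕ, HasSignChain g y n ∧ c * Real.log y ≤ n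

/-- The liminf form of the density implies the limsup form. [cite: Grosswald1967, §4 Thm B pp. 4–5] -/
theorem SignChainLowerDensity.signChainDensity {g : ℝ → ℝ} {D : ℝ}
    (h : SignChainLowerDensity g D) : SignChainDensity g D := by
  intro c hc y₀
  obtain ⟨y₁, hy₁⟩ := h c hc
  obtain ⟨n, hn, hcn⟩ := hy₁ (max y₀ y₁) (le_max_right _ _)
  exact ⟨max y₀ y₁, le_max_left _ _, n, hn, hcn⟩

/-- Densities are monotone: density `≥ D` gives density `≥ D'` for `D' ≤ D`. [cite: Grosswald1967, §4 Thm B pp. 4–5] -/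
theorem SignChainDensity.mono {g : ℝ → ℝ} {D D' : ℝ} (h : SignChainDensity g D) (hD : D' ≤ D) :
    SignChainDensity g D' :=
  fun c hc y₀ => h c (lt_of_lt_of_le hc hD) y₀

/-- The rate delivered by a pole pair `ρ = β + iγ`, `ρ̄` seen from the real point `λ` with truncation
parameter `x`: `λ · arctan(γ/(λ−β)) / (π x)` (→ `γ/π` as `λ → ∞`, `x → 1`). [cite: Grosswald1967, §4 Thm B pp. 4–5] -/
def polePairRate (lam x : ℝ) (ρ : ℂ) : ℝ :=
  lam * Real.arctan (ρ.im / (lam - ρ.re)) / (Real.pi * x)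

/-- **Admissible pole-pair data** for the moment method at the real point `λ` (all hypotheses of PieceA):
`g t^{-(σ₁+1)}` integrable on `(1,∞)`; `σ₁ < λ`, `0 < λ`; `ρ = β + iγ` with `γ > 0`, `β < λ`, inside the
open disc of radius `R'` about `λ`; truncation parameter `x > 1` with `x(λ−σ₁) ≥ λ` and the tail
inequality `x·exp(1 − x(λ−σ₁)/λ)·|λ−ρ| < λ`; `Ψ` holomorphic on the CLOSED disc minus `{ρ, ρ̄}`,
real-symmetric (`Ψ(s̄) = conj Ψ(s)`), equal to `mellinIoi g` near `λ`, with a GENUINE pole at `ρ`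
(`(s−ρ)^m Ψ(s) → A ≠ 0`, some `m ≥ 1`).  (The conjugate pole with `conj A`, same `m`, follows from symmetry.) [cite: Grosswald1967, §4 Thm B pp. 4–5] -/
def AdmissiblePolePair (g : ℝ → ℝ) (σ₁ lam x R' : ℝ) (ρ : ℂ) (Ψ : ℂ → ℂ) : Prop :=
  IntegrableOn (fun t : ℝ => g t * t ^ (-(σ₁ + 1))) (Ioi 1) ∧
  σ₁ < lam ∧ 0 < lam ∧ 0 < ρ.im ∧ ρ.re < lam ∧ ‖(lam : ℂ) - ρ‖ < R' ∧
  1 < x ∧ lam ≤ x * (lam - σ₁) ∧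
  x * Real.exp (1 - x * (lam - σ₁) / lam) * ‖(lam : ℂ) - ρ‖ < lam ∧
  DifferentiableOn ℂ Ψ (closedBall (lam : ℂ) R' \ {ρ, (starRingEnd ℂ) ρ}) ∧
  (∀ s ∈ closedBall (lam : ℂ) R', Ψ ((starRingEnd ℂ) s) = (starRingEnd ℂ) (Ψ s)) ∧
  (∃ r : ℝ, 0 < r ∧ EqOn Ψ (Landau.mellinIoi g) (ball (lam : ℂ) r)) ∧
  (∃ m : ℕ, 1 ≤ m ∧ ∃ A : ℂ, A ≠ 0 ∧
    Tendsto (fun s : ℂ => (s - ρ) ^ m * Ψ s) (𝓝[≠] ρ) (𝓝 A))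

/-- **PieceA — the counting lemma (Descartes–Laguerre moment method).**  Admissible pole-pair data at `λ`
force sign-chain density `≥ polePairRate λ x ρ = λ·arctan(γ/(λ−β))/(πx)` (limsup form; the proof sketched
in the module docstring gives the liminf form `SignChainLowerDensity`, which implies this one).
Proved in `Literature/NumberTheory/LFunctions/PolyaSignChangesCounting.lean`. [cite: Grosswald1967, §4 Thm B pp. 4–5] -/
def PieceA : Prop :=
  ∀ (g : ℝ → ℝ) (σ₁ lam x R' : ℝ) (ρ : ℂ) (Ψ : ℂ → ℂ),
    AdmissiblePolePair g σ₁ lam x R' ρ Ψ → SignChainDensity g (polePairRate lam x ρ)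

/-- **PieceB — pole bookkeeping / "infinite height".**  Under exactly the hypotheses of `Grosswald1967_thmB`
(continuation `Φ` meromorphic on `{θ − ε₀ < re}`, holomorphic on `{θ < re}` and on the box
`{θ − η < re, |im| < Γ}`, `F` not holomorphically continuable to any `{θ − ε < re}`), for every `ε > 0`
there are admissible pole-pair data `(λ, x, R', ρ, Ψ)` for the same `g, σ₁` with
`λ·arctan(γ/(λ−β))/x ≥ Γ − ε`.  Covers both `P ≠ ∅` and Pólya's gap case `P = ∅` (`γ = +∞`) uniformly:
`ρ` = the pole of the normal form of `Φ` nearest to a large generic `λ`.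
Proved in `Literature/NumberTheory/LFunctions/PolyaSignChangesInfiniteHeight.lean`. [cite: Grosswald1967, §4 Thm B pp. 4–5] -/
def PieceB : Prop :=
  ∀ (g : ℝ → ℝ) (σ₁ θ ε₀ : ℝ) (Φ : ℂ → ℂ),
    IntegrableOn (fun x : ℝ => g x * x ^ (-(σ₁ + 1))) (Ioi 1) →
    θ ≤ σ₁ → 0 < ε₀ →
    MeromorphicOn Φ {s : ℂ | θ - ε₀ < s.re} →
    DifferentiableOn ℂ Φ {s : ℂ | θ < s.re} →
    EqOn Φ (Landau.mellinIoi g) {s : ℂ | σ₁ < s.re} →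
    (∀ ε : ℝ, 0 < ε → ¬ ∃ Ψ : ℂ → ℂ, DifferentiableOn ℂ Ψ {s : ℂ | θ - ε < s.re} ∧
        EqOn Ψ (Landau.mellinIoi g) {s : ℂ | σ₁ < s.re}) →
    ∀ (Γ η : ℝ), 0 < Γ → 0 < η →
      DifferentiableOn ℂ Φ {s : ℂ | θ - η < s.re ∧ |s.im| < Γ} →
      ∀ ε : ℝ, 0 < ε → ∃ (lam x R' : ℝ) (ρ : ℂ) (Ψ : ℂ → ℂ),
        AdmissiblePolePair g σ₁ lam x R' ρ Ψ ∧ Γ - ε ≤ Real.pi * polePairRate lam x ρ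

/-- **The composition (kernel-checked): PieceA → PieceB → Theorem B.**  Given `c < Γ/π`, take
`ε := (Γ − πc)/2`, the admissible data of PieceB, and apply PieceA: `c < (Γ − ε)/π ≤ polePairRate`. [cite: Grosswald1967, §4 Thm B pp. 4–5] -/
theorem grosswald1967_thmB_of (hA : PieceA) (hB : PieceB) : Grosswald1967_thmB := by
  intro g σ₁ θ ε₀ Φ hint hθ hε₀ hmer hhol heq hno Γ η hΓ hη hbox c hc y₀
  have hπ : 0 < Real.pi := Real.pi_pos
  have hcπ : c * Real.pi < Γ := (lt_div_iff₀ hπ).1 hc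
  have hε : 0 < (Γ - Real.pi * c) / 2 := by nlinarith
  obtain ⟨lam, x, R', ρ, Ψ, hadm, hrate⟩ :=
    hB g σ₁ θ ε₀ Φ hint hθ hε₀ hmer hhol heq hno Γ η hΓ hη hbox ((Γ - Real.pi * c) / 2) hε
  have hc' : c < polePairRate lam x ρ := by
    have h2 : Real.pi * c < Real.pi * polePairRate lam x ρ := by linarith
    nlinarith
  exact hA g σ₁ lam x R' ρ Ψ hadm c hc' y₀

/-- Number of sign changes of a finite real sequence `a 0, …, a K` is at most `N`: every strictly increasing
chain of indices `≤ K` along which consecutive values have negative product has length `≤ N` (Laguerre–Descartes rule of signs for the truncated Mellin moments in the proof of Theorem B). [cite: Grosswald1967, §4 Thm B pp. 4–5] -/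
def SeqSignChangesLE (a : ℕ → ℝ) (K N : ℕ) : Prop :=
  ∀ (n : ℕ) (κ : Fin (n + 1) → ℕ), StrictMono κ → (∀ i, κ i ≤ K) →
    (∀ i : Fin n, a (κ i.castSucc) * a (κ i.succ) < 0) → n ≤ N

end Literature.NumberTheory.LFunctions.PolyaSignChanges

end
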